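import Literature.Probability.Process.ProgressiveDensity
import HarnessLib

/-!
# The Itô integral of a uniformly bounded progressive integrand (canonical Brownian motion)

Topic `Probability/Process`; a convenience wrapper around the tree's `L²` existence theorem
`Literature.Probability.Process.exists_isItoIntegral_of_sq_integrable` (Revuz–Yor IV Thm (2.2),
Prop. (2.8)): if `H` is progressively measurable for the raw Brownian filtration and uniformly
bounded, `|H t ω| ≤ C`, then the square-integrability hypothesis
`E ∫₀ᵗ H² ds < ∞` holds trivially (`≤ C² t`), so `∫ H dB` exists as a characterised Itô integral
which is a square-integrable martingale (`exists_isItoIntegral_of_abs_le`). The same three-line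
estimate is inlined in several SLE files (`ItoMartingale`, `SLEPointFlowIto`,
`SquaredBesselProofs`); this file is its shared home.

## References

* D. Revuz, M. Yor, *Continuous Martingales and Brownian Motion* (3rd ed., 1999), Ch. IV,
  Thm (2.2), Prop. (2.8).
-/

noncomputable section

open MeasureTheory Filter
open scoped NNReal ENNReal

namespace Literature.Probability.Process

/-- **The Itô integral of a bounded progressive integrand**: for `H` progressively measurable with
respect to the raw Brownian filtration and uniformly bounded (`|H t ω| ≤ C`), there is an Itô
integral `J = ∫ H dB` (in the sense of `IsItoIntegral`) which is a martingale with
`J t ∈ L²` for all `t`. (Wrapper around `exists_isItoIntegral_of_sq_integrable`: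
`E ∫₀ᵗ H² ds ≤ C² t < ∞`.) [cite: RevuzYor1999, Ch. IV Thm (2.2)] -/
theorem exists_isItoIntegral_of_abs_le {H : ℝ≥0 → (ℝ≥0 → ℝ) → ℝ}
    (hH : IsStronglyProgressive RandomPlanarGeometry.brownianFiltration H) {C : ℝ}
    (hC : ∀ t ω, |H t ω| ≤ C) :
    ∃ J : ℝ≥0 → (ℝ≥0 → ℝ) → ℝ,
      IsItoIntegral H brownian J RandomPlanarGeometry.brownianFiltration preWienerMeasure ∧
      Martingale J RandomPlanarGeometry.brownianFiltration preWienerMeasure ∧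
      ∀ t, MemLp (J t) 2 preWienerMeasure := by
  haveI := RandomPlanarGeometry.isProbabilityMeasure_preWienerMeasure'
  refine exists_isItoIntegral_of_sq_integrable hH fun t ↦ ?_
  have hle : ∀ ω : ℝ≥0 → ℝ, (∫⁻ s in Set.Icc (0 : ℝ) t, ENNReal.ofReal (H s.toNNReal ω ^ 2)) ≤
      ENNReal.ofReal (C ^ 2) * volume (Set.Icc (0 : ℝ) t) := by
    intro ω
    rw [← setLIntegral_const]
    refine lintegral_mono fun s ↦ ENNReal.ofReal_le_ofReal ?_
    rw [← sq_abs]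
    exact pow_le_pow_left₀ (abs_nonneg _) (hC _ _) 2
  refine ne_top_of_le_ne_top ?_ (lintegral_mono hle)
  rw [lintegral_const, measure_univ, mul_one, Real.volume_Icc, sub_zero]
  exact ENNReal.mul_ne_top ENNReal.ofReal_ne_top ENNReal.ofReal_ne_top

end Literature.Probability.Process
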